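import Literature.Probability.FitznerVanDerHofstad2017.Stage1EvalRem
import Literature.Probability.FitznerVanDerHofstad2017.Stage1TailsEval
import Literature.Probability.FitznerVanDerHofstad2017.BoundMapMonotone
import HarnessLib

/-!
# HOME DRAFT (pub-lace10 typer g10, 2026-08-23; NOT filed — lead RULING D29 (3)) — inventory §2 A7 / LEVELC-TASKS P2.1′, PART 1 (tree-only imports):
# order bookkeeping for «the typed Stage-1 recipe is MONOTONE IN THE COUNT TABLES» (`Stage1MonotoneInCounts`, STRUCTURE.md §5 C-2a)

WHAT.  Generic lemmas consumed by PART 2 (`Stage1MonoST10_DRAFT.lean`, over the ST10′ composite): (§0) `PX.evalQ` is order-preserving in atoms AND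
tables over `ℚ` (cast of the landed `PX.eval_mono_both`); the `1/(1−g)` and product-bracket order facts over `ℚ` (verbatim `ℚ` twins of
`Stage1Frame.inv_one_sub_mono` / `prod_anti` / `prod_mem`); (§1) the cell-36 constants `K4Q, K5Q ≥ 0` for `d ≥ 2` (the ANTITONICITY of the two cell-[109] ENGINE TEXTS
`EngText.piAlphaLowerCellQ` / `psiLowerCellQ` in their letters is in PART 2, next to their HOME-draft definitions); (§2) the CLOSED-FORM tail reading `Reading.closed S S̄` of cells 41–42 is MONOTONE IN THE INGREDIENTS `(u, B, M, B̄, w)` once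
`S ≥ 1`, `S̄ ≥ 1` entrywise — which every Neumann certificate `(1 − A)S = 1`, `A, S ≥ 0` gives (`one_le_of_cert`: `S = 1 + A S`) — including the DROPPED
pieces, by `L M L̄ − M = (L − 1) M L̄ + M (L̄ − 1)`; hence `total (Reading.closed S S̄)` is monotone in the ingredient record (`total_mono_ingr`);
(§3) one upper field of a domination may be re-targeted (`Inputs.Dom.update_psiAlphaIZeroMinusOneAroundEi`; transitivity `Inputs.Dom.trans` is LANDED, `BoundMapMonotone` :253).
HONEST FRAMING: order bookkeeping about typed formulas; no numeral of record, no table instance, no dimension, no percolation claim; nothing here is a cited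
fact — the `[cite:]` tags are LOCATORS of the notebook cells whose typed texts the lemmas are about.
-/

namespace Literature.Probability.FitznerVanDerHofstad2017

/-! ## §0 Order helpers over `ℚ` -/

namespace PX

variable {ι κ : Type}

/-- `PX.evalQ` is order-preserving in atoms AND tables (everything `≥ 0`): the rational form of `PX.eval_mono_both`. [cite: FitznerVanDerHofstad2017, notebook Percolation.nb cells 3–44 (transcript l.171–1237)] -/
theorem evalQ_mono_both {va va' : ι → ℚ} {vt vt' : κ → ℚ} (ha : ∀ i, 0 ≤ va i) (hale : ∀ i, va i ≤ va' i)
    (ht : ∀ k, 0 ≤ vt k) (hle : ∀ k, vt k ≤ vt' k) (e : PX ι κ) : evalQ va vt e ≤ evalQ va' vt' e := by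
  have h := eval_mono_both (va := fun i => (va i : ℝ)) (va' := fun i => (va' i : ℝ)) (vt := fun k => (vt k : ℝ))
    (vt' := fun k => (vt' k : ℝ)) (fun i => by exact_mod_cast ha i) (fun i => by exact_mod_cast hale i)
    (fun k => by exact_mod_cast ht k) (fun k => by exact_mod_cast hle k) e
  rw [eval_ratCast, eval_ratCast] at h
  exact_mod_cast h

/-- `PX.evalQ ≥ 0` at non-negative valuations: the rational form of `PX.eval_nonneg`. [cite: FitznerVanDerHofstad2017, notebook Percolation.nb cells 3–44 (transcript l.171–1237)] -/
theorem evalQ_nonneg {va : ι → ℚ} {vt : κ → ℚ} (ha : ∀ i, 0 ≤ va i) (ht : ∀ k, 0 ≤ vt k) (e : PX ι κ) :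
    0 ≤ evalQ va vt e := by
  have h := eval_nonneg (va := fun i => (va i : ℝ)) (vt := fun k => (vt k : ℝ)) (fun i => by exact_mod_cast ha i)
    (fun k => by exact_mod_cast ht k) e
  rw [eval_ratCast] at h
  exact_mod_cast h

/-- `PX.evalQ` is order-preserving in the tables at fixed atoms: the rational form of `PX.eval_mono_tab`. [cite: FitznerVanDerHofstad2017, notebook Percolation.nb cells 3–44 (transcript l.171–1237)] -/
theorem evalQ_mono_tab {va : ι → ℚ} {vt vt' : κ → ℚ} (ha : ∀ i, 0 ≤ va i) (ht : ∀ k, 0 ≤ vt k) (hle : ∀ k, vt k ≤ vt' k)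
    (e : PX ι κ) : evalQ va vt e ≤ evalQ va vt' e :=
  evalQ_mono_both ha (fun _ => le_rfl) ht hle e

end PX

namespace Stage1Cells

/-- `1/(1 − g) ≥ 0` for `g < 1` (over `ℚ`; twin of `Stage1Frame.Data.inv_one_sub_nonneg`). [cite: FitznerVanDerHofstad2016NoBLE, App. D pp. 1110–1117 (information order of the bound map)] -/
theorem inv_one_sub_nonnegQ {g : ℚ} (h : g < 1) : 0 ≤ 1 / (1 - g) := le_of_lt (one_div_pos.2 (by linarith))

/-- `1/(1 − g)` is monotone in `g < 1` (over `ℚ`; twin of `Stage1Frame.Data.inv_one_sub_mono`). [cite: FitznerVanDerHofstad2016NoBLE, App. D pp. 1110–1117 (information order of the bound map)] -/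
theorem inv_one_sub_monoQ {g g' : ℚ} (hle : g ≤ g') (h : g' < 1) : 1 / (1 - g) ≤ 1 / (1 - g') :=
  one_div_le_one_div_of_le (by linarith) (by linarith)

/-- `1 ≤ 1/(1 − g)` for `0 ≤ g < 1` (over `ℚ`). [cite: FitznerVanDerHofstad2016NoBLE, App. D pp. 1110–1117 (information order of the bound map)] -/
theorem one_le_inv_one_subQ {g : ℚ} (h0 : 0 ≤ g) (h : g < 1) : 1 ≤ 1 / (1 - g) := by
  rw [le_div_iff₀ (by linarith)]; linarith

/-- `(1 − a')(1 − b') ≤ (1 − a)(1 − b)` for `a ≤ a' ≤ 1`, `b ≤ b' ≤ 1` (over `ℚ`; twin of `Stage1Frame.prod_anti`). [cite: FitznerVanDerHofstad2016NoBLE, App. D pp. 1110–1117 (information order of the bound map)] -/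
theorem prod_antiQ {a a' b b' : ℚ} (ha : a ≤ a') (hb : b ≤ b') (ha1 : a' ≤ 1) (hb1 : b' ≤ 1) :
    (1 - a') * (1 - b') ≤ (1 - a) * (1 - b) :=
  mul_le_mul (by linarith) (by linarith) (by linarith) (by linarith)

/-- `0 ≤ (1 − a)(1 − b) ≤ 1` for `0 ≤ a, b ≤ 1` (over `ℚ`; twin of `Stage1Frame.prod_mem`). [cite: FitznerVanDerHofstad2016NoBLE, App. D pp. 1110–1117 (information order of the bound map)] -/
theorem prod_memQ {a b : ℚ} (ha0 : 0 ≤ a) (ha1 : a ≤ 1) (hb0 : 0 ≤ b) (hb1 : b ≤ 1) :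
    0 ≤ (1 - a) * (1 - b) ∧ (1 - a) * (1 - b) ≤ 1 :=
  ⟨mul_nonneg (by linarith) (by linarith), mul_le_one₀ (by linarith) (by linarith) (by linarith)⟩

/-! ## §1 The cell-36 constants are `≥ 0` -/

section KConsts

variable {P : Params}

/-- `0 < 2d − 1` over `ℚ` for `d ≥ 1`. [cite: FitznerVanDerHofstad2017, notebook Percolation.nb cell 36 (transcript l.1013–1026)] -/
theorem two_dQ_sub_one_pos (hd : 1 ≤ P.d) : 0 < 2 * dQ P - 1 := by
  have : (1 : ℚ) ≤ P.d := by exact_mod_cast hd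
  simp only [dQ]; linarith

/-- `0 ≤ z[i] = 1/(2d−1)` over `ℚ`. [cite: FitznerVanDerHofstad2017, notebook Percolation.nb cell 36 (transcript l.1013–1026)] -/
theorem zIrQ_nonneg (hd : 1 ≤ P.d) : 0 ≤ zIrQ P := le_of_lt (one_div_pos.2 (two_dQ_sub_one_pos hd))

/-- `z[i] ≤ 1` over `ℚ`. [cite: FitznerVanDerHofstad2017, notebook Percolation.nb cell 36 (transcript l.1013–1026)] -/
theorem zIrQ_le_one (hd : 1 ≤ P.d) : zIrQ P ≤ 1 := by
  have : (1 : ℚ) ≤ P.d := by exact_mod_cast hd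
  unfold zIrQ; rw [div_le_one (two_dQ_sub_one_pos hd)]; simp only [dQ]; linarith

/-- `0 ≤ 1 − z[i]^n`. [cite: FitznerVanDerHofstad2017, notebook Percolation.nb cell 36 (transcript l.1013–1026)] -/
theorem one_sub_zIrQ_pow_nonneg (hd : 1 ≤ P.d) (n : ℕ) : 0 ≤ 1 - zIrQ P ^ n :=
  sub_nonneg.2 (pow_le_one₀ (zIrQ_nonneg hd) (zIrQ_le_one hd))

/-- `K₄ ≥ 0` over `ℚ` for `d ≥ 2`. [cite: FitznerVanDerHofstad2017, notebook Percolation.nb cell 36] -/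
theorem K4Q_nonneg (hd : 2 ≤ P.d) : 0 ≤ K4Q P := by
  have hd' : (2 : ℚ) ≤ P.d := by exact_mod_cast hd
  have h1 : 0 ≤ 2 * dQ P - 2 := by simp only [dQ]; linarith
  have h2 : 0 ≤ 2 * dQ P - 3 := by simp only [dQ]; linarith
  have hz := zIrQ_nonneg (P := P) (by omega)
  have h3 := one_sub_zIrQ_pow_nonneg (P := P) (by omega) 3
  unfold K4Q; positivity

/-- `K₅ ≥ 0` over `ℚ` for `d ≥ 2`. [cite: FitznerVanDerHofstad2017, notebook Percolation.nb cell 36] -/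
theorem K5Q_nonneg (hd : 2 ≤ P.d) : 0 ≤ K5Q P := by
  have hd' : (2 : ℚ) ≤ P.d := by exact_mod_cast hd
  have h1 : 0 ≤ 2 * dQ P - 2 := by simp only [dQ]; linarith
  have h2 : 0 ≤ 2 * dQ P - 3 := by simp only [dQ]; linarith
  have hz := zIrQ_nonneg (P := P) (by omega)
  have h3 := one_sub_zIrQ_pow_nonneg (P := P) (by omega) 3
  unfold K5Q; positivity

end KConsts

end Stage1Cells

/-! ## §2 The closed-form tail reading is monotone in the ingredients -/

namespace Stage1Tails

open scoped Matrix
open Finset EigenTails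

section ClosedMono

variable {n : Type*} [Fintype n] [DecidableEq n]

/-- a Neumann certificate `(1 − A)·S = 1` with `A, S ≥ 0` gives `S = 1 + A·S ≥ 1` entrywise (diagonal `≥ 1`, off-diagonal `≥ 0`). [cite: FitznerVanDerHofstad2017, notebook Percolation.nb cells 41–42 (transcript l.1131–1175)] -/
theorem one_le_of_cert {A S : Matrix n n ℝ} (hA : ∀ i j, 0 ≤ A i j) (hS0 : ∀ i j, 0 ≤ S i j) (hS : (1 - A) * S = 1) :
    ∀ i j, (1 : Matrix n n ℝ) i j ≤ S i j := by
  have hS' : S = 1 + A * S := by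
    have h := hS; rw [Matrix.sub_mul, Matrix.one_mul] at h
    rw [← h]; abel
  intro i j
  have hAS : 0 ≤ (A * S) i j := mul_apply_nonneg hA hS0 i j
  have := congrFun (congrFun hS' i) j
  rw [Matrix.add_apply] at this
  linarith

/-- `Kind.L S ≥ 0` entrywise for `S ≥ 0`. [cite: FitznerVanDerHofstad2017, notebook Percolation.nb cells 41–42 (transcript l.1131–1175)] -/
theorem Kind.L_nonneg {S : Matrix n n ℝ} (hS0 : ∀ i j, 0 ≤ S i j) : ∀ (k : Kind) (i j : n), 0 ≤ k.L S i j
  | .one, i, j => hS0 i j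
  | .lin, i, j => mul_apply_nonneg hS0 hS0 i j
  | .delta, i, j => one_apply_nonneg i j

/-- `Kind.L S − 1 ≥ 0` entrywise for `S ≥ 1` (and `S ≥ 0`): `S − 1`, `S² − 1 = (S − 1)·S + (S − 1)`, `0`. [cite: FitznerVanDerHofstad2017, notebook Percolation.nb cells 41–42 (transcript l.1131–1175)] -/
theorem Kind.L_sub_one_nonneg {S : Matrix n n ℝ} (hS0 : ∀ i j, 0 ≤ S i j) (hS1 : ∀ i j, (1 : Matrix n n ℝ) i j ≤ S i j) :
    ∀ (k : Kind) (i j : n), 0 ≤ (k.L S - 1) i j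
  | .one, i, j => by rw [Matrix.sub_apply]; exact sub_nonneg.2 (hS1 i j)
  | .lin, i, j => by
      have h1 : ∀ i j, 0 ≤ (S - 1) i j := fun i j => by rw [Matrix.sub_apply]; exact sub_nonneg.2 (hS1 i j)
      have e : (Kind.lin.L S - 1 : Matrix n n ℝ) = (S - 1) * S + (S - 1) := by
        simp only [Kind.L, Matrix.sub_mul, Matrix.one_mul]; abel
      rw [e, Matrix.add_apply]
      exact add_nonneg (mul_apply_nonneg h1 hS0 i j) (h1 i j)
  | .delta, i, j => by simp [Kind.L]

variable {u u' : n → ℝ} {B B' M M' Bb Bb' : Matrix n n ℝ} {w w' : n → ℝ}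

/-- a sandwiched tail term `uᵀ B^α (X M Y) B̄^β w` with FIXED non-negative `X`, `Y` is monotone in the ingredients. [cite: FitznerVanDerHofstad2017, notebook Percolation.nb cells 41–42 (transcript l.1131–1175)] -/
theorem sandwichTerm_mono {X Y : Matrix n n ℝ} (hX : ∀ i j, 0 ≤ X i j) (hY : ∀ i j, 0 ≤ Y i j) (h : NN u B M Bb w)
    (hle : LE u B M Bb w u' B' M' Bb' w') (α β : ℕ) :
    u ⬝ᵥ ((B ^ α * (X * M * Y) * Bb ^ β) *ᵥ w) ≤ u' ⬝ᵥ ((B' ^ α * (X * M' * Y) * Bb' ^ β) *ᵥ w') := by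
  have hXM : ∀ i j, 0 ≤ (X * M) i j := fun i j => mul_apply_nonneg hX h.M i j
  have hXMY : ∀ i j, 0 ≤ (X * M * Y) i j := fun i j => mul_apply_nonneg hXM hY i j
  have hXMle : ∀ i j, (X * M) i j ≤ (X * M') i j := fun i j => mul_apply_mono hX h.M (fun _ _ => le_rfl) hle.M i j
  have hXMYle : ∀ i j, (X * M * Y) i j ≤ (X * M' * Y) i j := fun i j =>
    mul_apply_mono hXM hY hXMle (fun _ _ => le_rfl) i j
  have t := tailTerm_mono (φ := 1) zero_le_one h.u h.B hXMY h.Bb h.w hle.u hle.B hXMYle hle.Bb hle.w α β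
  simpa only [tailTerm, one_mul] using t

/-- algebra of the dropped piece: `uᵀ B^α (X M Y) B̄^β w − uᵀ B^α M B̄^β w = uᵀ B^α ((X − 1) M Y) B̄^β w + uᵀ B^α (M (Y − 1)) B̄^β w`. [cite: FitznerVanDerHofstad2017, notebook Percolation.nb cells 41–42 (transcript l.1131–1175)] -/
theorem closed_drop_split (u : n → ℝ) (B : Matrix n n ℝ) (α : ℕ) (X M Y : Matrix n n ℝ) (Bb : Matrix n n ℝ) (β : ℕ)
    (w : n → ℝ) :
    u ⬝ᵥ ((B ^ α * (X * M * Y) * Bb ^ β) *ᵥ w) - u ⬝ᵥ ((B ^ α * M * Bb ^ β) *ᵥ w)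
      = u ⬝ᵥ ((B ^ α * ((X - 1) * M * Y) * Bb ^ β) *ᵥ w) + u ⬝ᵥ ((B ^ α * (M * (Y - 1)) * Bb ^ β) *ᵥ w) := by
  have e : X * M * Y - M = (X - 1) * M * Y + M * (Y - 1) := by
    simp only [Matrix.sub_mul, Matrix.mul_sub, Matrix.one_mul, Matrix.mul_one]; abel
  rw [← sandwich_apply, ← sandwich_apply, ← sandwich_apply, ← sandwich_apply, ← map_sub, ← map_add, ← e]

/-- **the CLOSED-FORM READING is monotone in the ingredients** `(u, B, M, B̄, w)` (all `≥ 0`) once `S, S̄ ≥ 0` and `S, S̄ ≥ 1` entrywise —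
dropped pieces included. [cite: FitznerVanDerHofstad2017, notebook Percolation.nb cells 41–42 (transcript l.1131–1175)] -/
theorem closed_mono_ingr {S Sb : Matrix n n ℝ} (hS0 : ∀ i j, 0 ≤ S i j) (hS1 : ∀ i j, (1 : Matrix n n ℝ) i j ≤ S i j)
    (hSb0 : ∀ i j, 0 ≤ Sb i j) (hSb1 : ∀ i j, (1 : Matrix n n ℝ) i j ≤ Sb i j) (h : NN u B M Bb w)
    (hle : LE u B M Bb w u' B' M' Bb' w') (drop : Bool) (ψ χ : Kind) (α β : ℕ) :
    Reading.closed S Sb drop ψ χ u B α M Bb β w ≤ Reading.closed S Sb drop ψ χ u' B' α M' Bb' β w' := by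
  have hX := Kind.L_nonneg hS0 ψ
  have hY := Kind.L_nonneg hSb0 χ
  cases drop
  · simp only [Reading.closed, Bool.false_eq_true, if_false, sub_zero]
    exact sandwichTerm_mono hX hY h hle α β
  · simp only [Reading.closed, if_true]
    rw [closed_drop_split, closed_drop_split]
    have hX1 := Kind.L_sub_one_nonneg hS0 hS1 ψ
    have hY1 := Kind.L_sub_one_nonneg hSb0 hSb1 χ
    refine add_le_add (sandwichTerm_mono hX1 hY h hle α β) ?_
    have t := sandwichTerm_mono (X := (1 : Matrix n n ℝ)) (Y := χ.L Sb - 1) one_apply_nonneg hY1 h hle α β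
    simpa only [Matrix.one_mul] using t

/-- entrywise order of two ingredient records. [cite: FitznerVanDerHofstad2017, notebook Percolation.nb cells 41–42 (transcript l.1131–1175)] -/
structure Ingr.LE (I I' : Ingr n) : Prop where
  u : ∀ t i, I.u t i ≤ I'.u t i
  m : ∀ t i j, I.m t i j ≤ I'.m t i j
  w : ∀ t i, I.w t i ≤ I'.w t i
  B : ∀ i j, I.B i j ≤ I'.B i j
  Bb : ∀ i j, I.Bb i j ≤ I'.Bb i j

/-- the ingredient tuples of any piece compare. [cite: FitznerVanDerHofstad2017, notebook Percolation.nb cells 41–42 (transcript l.1131–1175)] -/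
theorem Ingr.LE.le {I I' : Ingr n} (h : I.LE I') (a : USym) (b : MSym) (c : WSym) :
    Stage1Tails.LE (I.u a) I.B (I.m b) I.Bb (I.w c) (I'.u a) I'.B (I'.m b) I'.Bb (I'.w c) :=
  ⟨h.u a, h.B, h.m b, h.Bb, h.w c⟩

/-- **a table of pieces under the closed-form reading is monotone in the ingredient record** (`S, S̄ ≥ 1`). [cite: FitznerVanDerHofstad2017, notebook Percolation.nb cells 41–42 (transcript l.1131–1175)] -/
theorem total_mono_ingr {S Sb : Matrix n n ℝ} (hS0 : ∀ i j, 0 ≤ S i j) (hS1 : ∀ i j, (1 : Matrix n n ℝ) i j ≤ S i j)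
    (hSb0 : ∀ i j, 0 ≤ Sb i j) (hSb1 : ∀ i j, (1 : Matrix n n ℝ) i j ≤ Sb i j) {I I' : Ingr n} (hI : I.Nonneg)
    (hle : I.LE I') : ∀ l : List Piece, total (Reading.closed S Sb) I l ≤ total (Reading.closed S Sb) I' l
  | [] => by simp
  | π :: l => by
    rw [total_cons, total_cons]
    refine add_le_add ?_ (total_mono_ingr hS0 hS1 hSb0 hSb1 hI hle l)
    exact mul_le_mul_of_nonneg_left
      (closed_mono_ingr hS0 hS1 hSb0 hSb1 (hI.nn _ _ _) (hle.le _ _ _) _ _ _ _ _) (Nat.cast_nonneg _)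

end ClosedMono

end Stage1Tails

/-! ## §3 Re-targeting one upper field of a domination (`Inputs.Dom.trans` itself is landed) -/

namespace BetaMap

/-- re-targeting the one upper field `psiAlphaIZeroMinusOneAroundEi` (cell 37-I) of the middle record of a domination: if `b.Dom c` and `m ≤ c.ψ^{αI}`, then
`{ b with psiAlphaIZeroMinusOneAroundEi := m }.Dom c`. [cite: FitznerVanDerHofstad2016NoBLE, App. D pp. 1110–1117 (information order of the bound map)] -/
theorem Inputs.Dom.update_psiAlphaIZeroMinusOneAroundEi {b c : Inputs} (h : b.Dom c) {m : ℝ}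
    (hm : m ≤ c.psiAlphaIZeroMinusOneAroundEi) : ({ b with psiAlphaIZeroMinusOneAroundEi := m } : Inputs).Dom c :=
  { h with psiAlphaIZeroMinusOneAroundEi := hm }

end BetaMap

end Literature.Probability.FitznerVanDerHofstad2017
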